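/-
Copyright (c) 2026. All rights reserved.
Released under Apache 2.0 license as described in the file LICENSE.
-/
import Mathlib
import Literature.NumberTheory.LFunctions.ZetaZeros
import Literature.NumberTheory.LFunctions.ZetaArgVariation
import Literature.NumberTheory.LFunctions.ZetaZerosProofs
import HarnessLib

/-!
# THEOREM P, core: no entire function of exponential type is divisible by `ζ` at every zero

`HANDOFF/prove-1` gen15, ATTEMPT-22 §2 (the complex-analytic heart of THEOREM P, «the
`S₀`-lattice tail of a nonzero admissible vector never vanishes on an interval `(0, δ)`»).

* `eventually_mul_le_zetaZeroCount` — from the tree's Riemann–von Mangoldt formula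
  (`riemann_von_mangoldt_holds`): for every `B`, eventually `B·T ≤ N(T)`.
* `entire_eq_zero_of_riemannZeta_dvd` — if `Φ` is entire with `‖Φ(s)‖ ≤ C·K^{‖s‖}` and, near
  EVERY nontrivial zero `ρ` of `ζ`, `Φ = ζ·M_ρ` with `M_ρ` analytic at `ρ`, then `Φ ≡ 0`.
  Proof: Jensen's inequality (Mathlib `AnalyticOnNhd.sum_divisor_le`) bounds the number of zeros of
  `Φ` (with multiplicity) in the disc of radius `r = ‖c‖ + T + 2` about a point `c` with
  `Φ c ≠ 0` by `log(M(2r)/‖Φ c‖)/log 2 = O(T)`, while those zeros include the box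
  `0 < Im ρ ≤ T` of zeta zeros with their multiplicities, `N(T) ≍ T log T` of them.

Nothing here bears on the truth of RH.
-/

noncomputable section

set_option linter.dupNamespace false

open Complex MeasureTheory Set Filter Metric MeromorphicOn
open Literature.NumberTheory.LFunctions

namespace Summit.RiemannHypothesis.RiemannHypothesis.Theorems

namespace LatticeUncertainty

/-! ## The zero count of `ζ` beats every linear function -/

/-- From the Riemann–von Mangoldt formula `N(T) = (T/2π) log(T/2π) − T/2π + O(log T)`
(tree: `riemann_von_mangoldt_holds`): for every real `B`, eventually `B · T ≤ N(T)`. -/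
theorem eventually_mul_le_zetaZeroCount (B : ℝ) :
    ∀ᶠ T : ℝ in atTop, B * T ≤ (zetaZeroCount T : ℝ) := by
  obtain ⟨C₀, hC₀, hbd⟩ := riemann_von_mangoldt_holds.exists_pos
  have h2 : ∀ᶠ T : ℝ in atTop, 2 + 2 * Real.pi * (|B| + 1) ≤ Real.log (T / (2 * Real.pi)) :=
    (Real.tendsto_log_atTop.comp (tendsto_id.atTop_div_const (by positivity))).eventually_ge_atTop
      _
  have h3 : ∀ᶠ T : ℝ in atTop, ‖Real.log T‖ ≤ (1 / (2 * Real.pi * C₀)) * ‖T‖ :=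
    Real.isLittleO_log_id_atTop.def (by positivity)
  filter_upwards [hbd.bound, h2, h3, eventually_ge_atTop (1 : ℝ)] with T hb h2 h3 h1
  rw [Real.norm_of_nonneg (Real.log_nonneg h1)] at hb h3
  rw [Real.norm_of_nonneg (by linarith : (0 : ℝ) ≤ T)] at h3
  rw [Real.norm_eq_abs] at hb
  have hb' := (abs_le.1 hb).1
  have h4 : T / (2 * Real.pi) * (2 + 2 * Real.pi * (|B| + 1)) ≤
      T / (2 * Real.pi) * Real.log (T / (2 * Real.pi)) :=
    mul_le_mul_of_nonneg_left h2 (by positivity)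
  have h5 : C₀ * Real.log T ≤ T / (2 * Real.pi) := by
    calc C₀ * Real.log T ≤ C₀ * ((1 / (2 * Real.pi * C₀)) * T) :=
          mul_le_mul_of_nonneg_left h3 hC₀.le
      _ = T / (2 * Real.pi) := by field_simp
  have h6 : T / (2 * Real.pi) * (2 + 2 * Real.pi * (|B| + 1)) =
      2 * (T / (2 * Real.pi)) + (|B| + 1) * T := by
    field_simp
  have h7 : B * T ≤ (|B| + 1) * T := by nlinarith [le_abs_self B]
  linarith

/-- There are `T ≥ 1` with `N(T) > A + B·T`, for all real `A`, `B`. -/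
theorem exists_lt_zetaZeroCount (A B : ℝ) :
    ∃ T : ℝ, 1 ≤ T ∧ A + B * T < (zetaZeroCount T : ℝ) := by
  have h := eventually_mul_le_zetaZeroCount (|A| + B + 1)
  obtain ⟨T, hT, hT1⟩ := (h.and (eventually_ge_atTop (1 : ℝ))).exists
  refine ⟨T, hT1, ?_⟩
  have : A ≤ |A| * T := (le_abs_self A).trans (le_mul_of_one_le_right (abs_nonneg A) hT1)
  nlinarith

/-! ## Jensen's inequality against the zero count -/

/-- The box of zeta zeros `0 ≤ Re ρ ≤ 1`, `0 < Im ρ ≤ T` lies in the closed disc of radius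
`‖c‖ + T + 2` about any centre `c` (for `T ≥ 0`). -/
theorem zetaZeroBox_subset_closedBall (c : ℂ) (T : ℝ) :
    zetaZeroBox 0 T ⊆ closedBall c (‖c‖ + T + 2) := by
  rintro ρ ⟨-, h0, h1, h2, h3⟩
  rw [mem_closedBall, dist_comm, dist_eq_norm]
  have hρ : ‖ρ‖ ≤ |ρ.re| + |ρ.im| := Complex.norm_le_abs_re_add_abs_im ρ
  have hre : |ρ.re| ≤ 1 := abs_le.2 ⟨by linarith, h1⟩
  have him : |ρ.im| ≤ T := abs_le.2 ⟨by linarith, h3⟩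
  calc ‖c - ρ‖ ≤ ‖c‖ + ‖ρ‖ := norm_sub_le _ _
    _ ≤ ‖c‖ + T + 2 := by linarith

/-- At a nontrivial zero `ρ`, if `Φ = ζ·M` near `ρ` with `M` analytic at `ρ` and `Φ` is not
locally zero, the analytic order of `Φ` at `ρ` is at least the multiplicity `m(ρ)` of `ζ`. -/
theorem riemannZetaZeroOrder_le_of_eventuallyEq {Φ M : ℂ → ℂ} {ρ : ℂ} (hρ1 : ρ ≠ 1)
    (hM : AnalyticAt ℂ M ρ)
    (heq : Φ =ᶠ[nhds ρ] fun s ↦ riemannZeta s * M s) {k : ℕ} (hk : analyticOrderAt Φ ρ = k) :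
    riemannZetaZeroOrder ρ ≤ k := by
  have hζ : AnalyticAt ℂ riemannZeta ρ := analyticOn_riemannZeta ρ hρ1
  have hmul : analyticOrderAt Φ ρ = analyticOrderAt riemannZeta ρ + analyticOrderAt M ρ := by
    rw [analyticOrderAt_congr heq]
    exact analyticOrderAt_mul hζ hM
  rw [hk] at hmul
  -- the order of `ζ` at `ρ` is finite and `≤ k`
  have hne : analyticOrderAt riemannZeta ρ ≠ ⊤ := by
    intro htop
    rw [htop, top_add] at hmul
    exact ENat.coe_ne_top k hmul
  obtain ⟨m, hm⟩ := ENat.ne_top_iff_exists.mp hne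
  have hmk : m ≤ k := by
    have : (m : ℕ∞) ≤ k := by rw [hmul, ← hm]; exact le_self_add
    exact_mod_cast this
  have : riemannZetaZeroOrder ρ = m := by
    rw [riemannZetaZeroOrder, hζ.meromorphicOrderAt_eq, ← hm]
    rfl
  rw [this]
  exact_mod_cast hmk

/-- **THEOREM P, core.** An entire function of exponential type (`‖Φ s‖ ≤ C·K^{‖s‖}`) which,
near every nontrivial zero `ρ` of `ζ`, factors as `ζ · M_ρ` with `M_ρ` analytic at `ρ`, is
identically zero: by Jensen's inequality it has `O(T)` zeros in discs of radius `≍ T`, but it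
vanishes (with multiplicity) on the `N(T) ≍ T log T` zeta zeros up to height `T`. -/
theorem entire_eq_zero_of_riemannZeta_dvd {Φ : ℂ → ℂ} (hΦ : Differentiable ℂ Φ) {C K : ℝ}
    (hK : 1 ≤ K) (hbound : ∀ s, ‖Φ s‖ ≤ C * K ^ ‖s‖)
    (hzero : ∀ ρ : ℂ, riemannZeta ρ = 0 → 0 < ρ.re → ρ.re < 1 →
      ∃ M : ℂ → ℂ, AnalyticAt ℂ M ρ ∧ Φ =ᶠ[nhds ρ] fun s ↦ riemannZeta s * M s) :
    Φ = 0 := by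
  by_contra hne
  obtain ⟨c, hc⟩ : ∃ c, Φ c ≠ 0 := Function.ne_iff.mp hne
  have hΦan : AnalyticOnNhd ℂ Φ univ := hΦ.differentiableOn.analyticOnNhd isOpen_univ
  have hCpos : 0 < C := by
    have h1 : 0 < ‖Φ c‖ := norm_pos_iff.mpr hc
    have h2 := hbound c
    have h3 : 0 < K ^ ‖c‖ := Real.rpow_pos_of_pos (by linarith) _
    nlinarith
  have hlogK : 0 ≤ Real.log K := Real.log_nonneg hK
  -- `Φ` is nowhere locally zero
  have horder : ∀ z, analyticOrderAt Φ z ≠ ⊤ := by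
    intro z htop
    have h0 : Φ =ᶠ[nhds z] 0 := analyticOrderAt_eq_top.mp htop
    have := hΦan.eqOn_zero_of_preconnected_of_eventuallyEq_zero isPreconnected_univ
      (mem_univ z) h0 (mem_univ c)
    exact hc this
  -- the linear bound on `N(T)`
  set A : ℝ := (|Real.log C| + (3 * ‖c‖ + 4) * Real.log K - Real.log ‖Φ c‖) / Real.log 2
    with hA_def
  set B : ℝ := 2 * Real.log K / Real.log 2 with hB_def
  have hlog2 : 0 < Real.log 2 := Real.log_pos one_lt_two
  have key : ∀ T : ℝ, 1 ≤ T → (zetaZeroCount T : ℝ) ≤ A + B * T := by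
    intro T hT
    set r : ℝ := ‖c‖ + T + 2 with hr_def
    have hr : 0 < r := by positivity
    have habsr : |r| = r := abs_of_pos hr
    have habsR : |2 * r| = 2 * r := abs_of_pos (by positivity)
    set M : ℝ := max 1 (C * K ^ (‖c‖ + 2 * r)) with hM_def
    have hM1 : 1 ≤ M := le_max_left _ _
    -- Jensen
    have hJ := AnalyticOnNhd.sum_divisor_le (f := Φ) (c := c) (r := r) (R := 2 * r) (M := M)
      (by rw [habsr]; exact hr) (by rw [habsr, habsR]; linarith) hM1
      (hΦan.mono (subset_univ _)) hc (by
        intro z hz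
        rw [habsR] at hz
        have hz' : ‖z‖ ≤ ‖c‖ + 2 * r := by
          have h1 : ‖z - c‖ = 2 * r := by rw [← dist_eq_norm]; exact hz
          calc ‖z‖ = ‖c + (z - c)‖ := by ring_nf
            _ ≤ ‖c‖ + ‖z - c‖ := norm_add_le _ _
            _ = ‖c‖ + 2 * r := by rw [h1]
        calc ‖Φ z‖ ≤ C * K ^ ‖z‖ := hbound z
          _ ≤ C * K ^ (‖c‖ + 2 * r) := by
            gcongr
          _ ≤ M := le_max_right _ _)
    have h2r : (2 * r / r : ℝ) = 2 := by field_simp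
    rw [habsr, h2r] at hJ
    -- the divisor dominates the zeta multiplicities on the box
    have hΦball : AnalyticOnNhd ℂ Φ (closedBall c r) := hΦan.mono (subset_univ _)
    set D := MeromorphicOn.divisor Φ (closedBall c r) with hD_def
    have hDnn : ∀ u, 0 ≤ D u := fun u ↦ hΦball.divisor_nonneg u
    have hDfin : (Function.support D).Finite := D.finiteSupport (isCompact_closedBall c r)
    have hbox := zetaZeroBox_subset_closedBall c T
    have hboxfin := zetaZeroBox_finite 0 T
    have hterm : ∀ ρ ∈ zetaZeroBox 0 T, riemannZetaZeroOrder ρ ≤ D ρ := by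
      intro ρ hρ
      have hρball : ρ ∈ closedBall c r := hbox hρ
      obtain ⟨hζ0, -, -, him, -⟩ := hρ
      obtain ⟨hre0, hre1⟩ := re_mem_Ioo_of_riemannZeta_eq_zero_of_im_ne_zero hζ0 him.ne'
      have hρ1 : ρ ≠ 1 := by
        intro h; rw [h, one_re] at hre1; exact lt_irrefl _ hre1
      obtain ⟨Mρ, hMρ, heq⟩ := hzero ρ hζ0 hre0 hre1
      obtain ⟨k, hk⟩ := ENat.ne_top_iff_exists.mp (horder ρ)
      have hle := riemannZetaZeroOrder_le_of_eventuallyEq hρ1 hMρ heq hk.symm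
      have hD : D ρ = k := by
        rw [hD_def, hΦball.divisor_apply hρball, ← hk]
        rfl
      rw [hD]
      exact hle
    have hsum : (zetaZeroCount T : ℤ) ≤ ∑ᶠ u, D u := by
      rw [zetaZeroCount_eq_finsum, finsum_mem_eq_finite_toFinset_sum _ hboxfin,
        finsum_eq_sum_of_support_subset D
          (s := hboxfin.toFinset ∪ hDfin.toFinset) (by
            intro u hu
            simp only [Finset.coe_union, Set.Finite.coe_toFinset]
            exact Or.inr hu)]
      calc ∑ ρ ∈ hboxfin.toFinset, riemannZetaZeroOrder ρ
          ≤ ∑ ρ ∈ hboxfin.toFinset, D ρ :=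
            Finset.sum_le_sum fun ρ hρ ↦ hterm ρ (hboxfin.mem_toFinset.mp hρ)
        _ ≤ ∑ u ∈ hboxfin.toFinset ∪ hDfin.toFinset, D u :=
            Finset.sum_le_sum_of_subset_of_nonneg Finset.subset_union_left
              fun u _ _ ↦ hDnn u
    have hsumR : (zetaZeroCount T : ℝ) ≤ ((∑ᶠ u, D u : ℤ) : ℝ) := by exact_mod_cast hsum
    -- the Jensen bound is linear in `T`
    have hMle : Real.log M ≤ |Real.log C| + (‖c‖ + 2 * r) * Real.log K := by
      rcases le_total (C * K ^ (‖c‖ + 2 * r)) 1 with h | h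
      · rw [hM_def, max_eq_left h, Real.log_one]
        positivity
      · rw [hM_def, max_eq_right h, Real.log_mul hCpos.ne' (by positivity),
          Real.log_rpow (by linarith)]
        linarith [le_abs_self (Real.log C)]
    have hJ' : (zetaZeroCount T : ℝ) ≤ (Real.log M - Real.log ‖Φ c‖) / Real.log 2 := by
      rw [← Real.log_div (by positivity) (norm_pos_iff.mpr hc).ne']
      exact hsumR.trans hJ
    have hfinal : (Real.log M - Real.log ‖Φ c‖) / Real.log 2 ≤ A + B * T := by
      have hid : (‖c‖ + 2 * r) * Real.log K =
          (3 * ‖c‖ + 4) * Real.log K + 2 * Real.log K * T := by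
        rw [hr_def]; ring
      have hnum : Real.log M - Real.log ‖Φ c‖ ≤
          (|Real.log C| + (3 * ‖c‖ + 4) * Real.log K - Real.log ‖Φ c‖) + 2 * Real.log K * T := by
        linarith
      calc (Real.log M - Real.log ‖Φ c‖) / Real.log 2
          ≤ ((|Real.log C| + (3 * ‖c‖ + 4) * Real.log K - Real.log ‖Φ c‖) + 2 * Real.log K * T) /
              Real.log 2 := div_le_div_of_nonneg_right hnum hlog2.le
        _ = A + B * T := by rw [hA_def, hB_def]; field_simp
    exact hJ'.trans hfinal
  obtain ⟨T, hT1, hT⟩ := exists_lt_zetaZeroCount A B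
  exact absurd (key T hT1) (not_le.mpr hT)

end LatticeUncertainty

end Summit.RiemannHypothesis.RiemannHypothesis.Theorems
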